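import Summits.QuantumFields.YangMills.Theorems.CentreWallReflectionSlabKernel
import Literature.Barriers.QuantumFields.FiniteTemperatureReflection
import HarnessLib

/-!
# Slab decomposition of the four-torus Wilson weight, IV: the slab reflection and the symmetry `Ψ_j(X,A) = Ψ_j(A,X)`
# (crux `CentreWallReflection.WallReflection` ⟨stmt-QuantumFields-23707⟩, line `birth`, stub `stub_instantiate`; planner ym-idea-4 g18)

The reflection `x_μ ↦ j − x_μ` (temporal links reversed and inverted) preserves product Haar measure and the slab action (a plaquette of the slab
goes to a plaquette of the slab with holonomy conjugate-inverse; `Re tr ρ` is blind to both for unitary `ρ`), and exchanges the two boundary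
data of a glued configuration; hence the slab kernel is SYMMETRIC — the reflection-positivity bookkeeping of the line.
HONEST FRAMING: lattice bookkeeping toward ONE crux of a draft route (fixed torus, finite lattice); nothing here proves the route's target
`MarginalTwistOnset.FixedTorusCriterionFailure`, any continuum statement, or the Yang–Mills mass gap.  THEOREMS ONLY (no `def`, no `sorry`),
standard axioms.  References: [cite: OsterwalderSeiler1978, §2]; [cite: tHooft1979]; E. T. Tomboulis, L. G. Yaffe, CMP 100 (1985) 313;
[cite: Luscher1983, §2].
-/

set_option autoImplicit false

noncomputable section

open scoped BigOperators
open MeasureTheory Literature.MathematicalPhysics.QuantumFieldTheory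

namespace Summit.QuantumFields.YangMills.Theorems.CentreWallReflection.Slab

open MeasureTheory

/-! ## §12 The slab reflection and the symmetry of the slab kernel -/

section Reflection

variable {n : ℕ} {G : Type*} [Group G] {N : ℕ} (ρ : G →* Matrix (Fin N) (Fin N) ℂ) (μ : Fin 4) (j : ℕ)

omit [Group G] in
/-- `siteReflect_apply_self` (slab bookkeeping, see the module docstring). -/
@[simp] theorem siteReflect_apply_self (x : Site 4 (n + 1)) : siteReflect μ j x μ = (j : ZMod (n + 1)) - x μ := by
  simp [siteReflect]

omit [Group G] in
/-- `siteReflect_apply_of_ne` (slab bookkeeping, see the module docstring). -/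
@[simp] theorem siteReflect_apply_of_ne (x : Site 4 (n + 1)) {k : Fin 4} (hk : k ≠ μ) : siteReflect μ j x k = x k := by
  simp [siteReflect, hk]

omit [Group G] in
/-- `siteReflect_siteReflect` (slab bookkeeping, see the module docstring). -/
theorem siteReflect_siteReflect (x : Site 4 (n + 1)) : siteReflect μ j (siteReflect μ j x) = x := by
  ext k; by_cases hk : k = μ
  · subst hk; simp
  · simp [hk]

omit [Group G] in
/-- `siteReflect_shift_of_ne` (slab bookkeeping, see the module docstring). -/
theorem siteReflect_shift_of_ne (x : Site 4 (n + 1)) {k : Fin 4} (hk : k ≠ μ) :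
    siteReflect μ j (x.shift k) = (siteReflect μ j x).shift k := by
  ext i
  by_cases hi : i = μ
  · subst hi; simp [Site.shift, Pi.single_eq_of_ne (Ne.symm hk)]
  · by_cases hik : i = k
    · subst hik; simp [Site.shift, hi]
    · simp [Site.shift, hi, Pi.single_eq_of_ne hik]

omit [Group G] in
/-- `siteReflect_shift_shift` (slab bookkeeping, see the module docstring). -/
theorem siteReflect_shift_shift (x : Site 4 (n + 1)) : (siteReflect μ j (x.shift μ)).shift μ = siteReflect μ j x := by
  ext i
  by_cases hi : i = μ
  · subst hi; simp [Site.shift]; ring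
  · simp [Site.shift, hi]

omit [Group G] in
/-- `siteReflect_shift_siteReflect_shift` (slab bookkeeping, see the module docstring). -/
theorem siteReflect_shift_siteReflect_shift (x : Site 4 (n + 1)) :
    siteReflect μ j ((siteReflect μ j (x.shift μ)).shift μ) = x := by
  rw [siteReflect_shift_shift, siteReflect_siteReflect]

omit [Group G] in
/-- `edgeReflect_edgeReflect` (slab bookkeeping, see the module docstring). -/
theorem edgeReflect_edgeReflect (e : Edge 4 (n + 1)) : edgeReflect μ j (edgeReflect μ j e) = e := by
  obtain ⟨x, k⟩ := e
  unfold edgeReflect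
  by_cases hk : k = μ
  · subst hk
    simp only [if_true, Prod.mk.injEq, and_true]
    exact siteReflect_shift_siteReflect_shift k j x
  · simp only [hk, if_false]
    rw [siteReflect_siteReflect]

/-- `slabReflect_apply` (slab bookkeeping, see the module docstring). -/
theorem slabReflect_apply (W : GaugeConfig 4 (n + 1) G) (e : Edge 4 (n + 1)) :
    slabReflect μ j W e = (if e.2 = μ then (fun g : G => g⁻¹) else id) (W (edgeReflect μ j e)) := by
  unfold slabReflect edgeReflect
  split_ifs <;> rfl

end Reflection

end Summit.QuantumFields.YangMills.Theorems.CentreWallReflection.Slab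

namespace Summit.QuantumFields.YangMills.Theorems.CentreWallReflection.Slab

open MeasureTheory

section ReflectionProps

variable {n : ℕ} {G : Type*} [Group G] {N : ℕ} (ρ : G →* Matrix (Fin N) (Fin N) ℂ) (μ : Fin 4) (j : ℕ)

/-- `val` of `j - t` for `j ≤ n`. -/
theorem val_natCast_sub (t : ZMod (n + 1)) (hj : j ≤ n) :
    ((j : ZMod (n + 1)) - t).val = if t.val ≤ j then j - t.val else j + (n + 1) - t.val := by
  have hjv : ((j : ZMod (n + 1))).val = j := by
    rw [ZMod.val_natCast]; exact Nat.mod_eq_of_lt (by omega)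
  have ht : t.val < n + 1 := ZMod.val_lt t
  split_ifs with h
  · rw [ZMod.val_sub (by rw [hjv]; exact h), hjv]
  · push Not at h
    set u := (j : ZMod (n + 1)) - t with hu
    have hu' : (j : ZMod (n + 1)) = u + t := by rw [hu, sub_add_cancel]
    have huv : u.val < n + 1 := ZMod.val_lt u
    have key : j = (u.val + t.val) % (n + 1) := by rw [← hjv, hu', ZMod.val_add]
    by_cases hlt : u.val + t.val < n + 1
    · rw [Nat.mod_eq_of_lt hlt] at key; omega
    · push Not at hlt
      rw [Nat.mod_eq_sub_mod hlt, Nat.mod_eq_of_lt (by omega)] at key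
      omega

/-- `val` of `t + 1`. -/
theorem val_add_one (t : ZMod (n + 1)) : (t + 1).val = if t.val < n then t.val + 1 else 0 := by
  have ht : t.val < n + 1 := ZMod.val_lt t
  rw [ZMod.val_add, ZMod.val_one_eq_one_mod, Nat.add_mod_mod]
  split_ifs with h
  · exact Nat.mod_eq_of_lt (by omega)
  · have : t.val + 1 = n + 1 := by omega
    rw [this, Nat.mod_self]

omit [Group G] in
/-- `plaqReflect_plaqReflect` (slab bookkeeping, see the module docstring). -/
theorem plaqReflect_plaqReflect (p : Plaquette 4 (n + 1)) : plaqReflect μ j (plaqReflect μ j p) = p := by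
  obtain ⟨x, ab⟩ := p
  unfold plaqReflect
  by_cases hT : isTemporal μ (x, ab) = true
  · have hT' : isTemporal μ (siteReflect μ j (x.shift μ), ab) = true := hT
    rw [if_pos hT]; dsimp only; rw [if_pos hT', siteReflect_shift_siteReflect_shift]
  · have hT' : ¬ isTemporal μ (siteReflect μ j x, ab) = true := hT
    rw [if_neg hT]; dsimp only; rw [if_neg hT', siteReflect_siteReflect]

/-- The reflection preserves the slab weights. -/
theorem slabWeight_plaqReflect (hjn : j ≤ n) (p : Plaquette 4 (n + 1)) :
    slabWeight μ j (plaqReflect μ j p) = slabWeight μ j p := by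
  obtain ⟨x, ab⟩ := p
  have ht : (x μ).val < n + 1 := ZMod.val_lt _
  unfold slabWeight plaqReflect
  by_cases hT : isTemporal μ (x, ab) = true
  · have hT' : isTemporal μ (siteReflect μ j (x.shift μ), ab) = true := hT
    rw [if_pos hT]; dsimp only; rw [if_pos hT', if_pos hT]
    have hlev : (siteReflect μ j (x.shift μ) μ).val = ((j : ZMod (n + 1)) - (x μ + 1)).val := by
      rw [siteReflect_apply_self, shift_apply_self']
    have hv := val_natCast_sub (n := n) j (x μ + 1) hjn
    rw [val_add_one] at hv
    generalize ((j : ZMod (n + 1)) - (x μ + 1)).val = v at hv hlev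
    rw [hlev]
    split_ifs at hv ⊢ <;> first | rfl | (exfalso; omega)
  · have hT' : ¬ isTemporal μ (siteReflect μ j x, ab) = true := hT
    rw [if_neg hT]; dsimp only; rw [if_neg hT', if_neg hT]
    have hlev : (siteReflect μ j x μ).val = ((j : ZMod (n + 1)) - x μ).val := by rw [siteReflect_apply_self]
    have hv := val_natCast_sub (n := n) j (x μ) hjn
    generalize ((j : ZMod (n + 1)) - x μ).val = v at hv hlev
    rw [hlev]
    split_ifs at hv ⊢ <;> first | rfl | (exfalso; omega)

/-- `Re tr ρ(a⁻¹ h⁻¹ a) = Re tr ρ(h)` for unitary `ρ`. -/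
theorem re_trace_map_conj_inv (hU : ∀ g, ρ g ∈ Matrix.unitaryGroup (Fin N) ℂ) (a h : G) :
    (ρ (a⁻¹ * h⁻¹ * a)).trace.re = (ρ h).trace.re := by
  rw [map_mul, map_mul, Matrix.trace_mul_cycle, ← map_mul, ← map_mul, mul_inv_cancel, one_mul]
  exact Literature.Barriers.QuantumFields.FiniteTemperature.trace_re_rep_inv ρ hU h

/-- The plaquette holonomies of the reflected configuration. -/
theorem plaquetteHolonomy_slabReflect (W : GaugeConfig 4 (n + 1) G) (x : Site 4 (n + 1)) {a b : Fin 4} (hab : a < b) :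
    plaquetteHolonomy (slabReflect μ j W) x a b =
      if a = μ ∨ b = μ then
        (W (siteReflect μ j (x.shift μ), μ))⁻¹ * (plaquetteHolonomy W (siteReflect μ j (x.shift μ)) a b)⁻¹ *
          W (siteReflect μ j (x.shift μ), μ)
      else plaquetteHolonomy W (siteReflect μ j x) a b := by
  have hne : a ≠ b := ne_of_lt hab
  set y := siteReflect μ j (x.shift μ) with hy
  by_cases haμ : a = μ
  · subst haμ
    have hba : b ≠ a := hne.symm
    rw [if_pos (Or.inl rfl)]
    simp only [plaquetteHolonomy, slabReflect, if_true, hba, if_false]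
    have e1 : siteReflect a j ((x.shift b).shift a) = y.shift b := by
      rw [WilsonRP.shift_comm, siteReflect_shift_of_ne a j _ hba]
    have e2 : siteReflect a j (x.shift a) = y := rfl
    have e3 : siteReflect a j x = y.shift a := (siteReflect_shift_shift a j x).symm
    rw [e1, e2, e3]
    group
  · have hbμ_or := hab
    by_cases hbμ : b = μ
    · subst hbμ
      rw [if_pos (Or.inr rfl)]
      simp only [plaquetteHolonomy, slabReflect, if_true, haμ, if_false]
      have e1 : siteReflect b j ((x.shift a).shift b) = y.shift a := by
        rw [← WilsonRP.shift_comm, siteReflect_shift_of_ne b j _ haμ]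
      have e2 : siteReflect b j (x.shift b) = y := rfl
      have e3 : siteReflect b j x = y.shift b := (siteReflect_shift_shift b j x).symm
      rw [e1, e2, e3]
      group
    · rw [if_neg (by push Not; exact ⟨haμ, hbμ⟩)]
      simp only [plaquetteHolonomy, slabReflect, haμ, hbμ, if_false, siteReflect_shift_of_ne μ j _ haμ,
        siteReflect_shift_of_ne μ j _ hbμ]

/-- **The slab action is reflection invariant.** -/
theorem slabAction_slabReflect (hU : ∀ g, ρ g ∈ Matrix.unitaryGroup (Fin N) ℂ) (hjn : j ≤ n)
    (W : GaugeConfig 4 (n + 1) G) : slabAction ρ μ j (slabReflect μ j W) = slabAction ρ μ j W := by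
  unfold slabAction
  have hpt : ∀ p : Plaquette 4 (n + 1), plaqCost ρ (slabReflect μ j W) p = plaqCost ρ W (plaqReflect μ j p) := by
    rintro ⟨x, ⟨⟨a, b⟩, hab⟩⟩
    simp only [plaqCost, plaqReflect]
    rw [plaquetteHolonomy_slabReflect μ j W x hab]
    by_cases hT : isTemporal μ (x, ⟨(a, b), hab⟩) = true
    · have hT' : a = μ ∨ b = μ := (isTemporal_iff μ _).mp hT
      rw [if_pos hT', if_pos hT, re_trace_map_conj_inv ρ hU]
    · have hT' : ¬ (a = μ ∨ b = μ) := fun h => hT ((isTemporal_iff μ _).mpr h)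
      rw [if_neg hT', if_neg hT]
  calc ∑ p, slabWeight μ j p * plaqCost ρ (slabReflect μ j W) p
      = ∑ p, slabWeight μ j (plaqReflect μ j p) * plaqCost ρ W (plaqReflect μ j p) := by
        refine Finset.sum_congr rfl fun p _ => ?_
        rw [hpt, slabWeight_plaqReflect μ j hjn]
    _ = ∑ p, slabWeight μ j p * plaqCost ρ W p :=
        Equiv.sum_comp (Function.Involutive.toPerm (plaqReflect μ j) (plaqReflect_plaqReflect μ j))
          (fun p => slabWeight μ j p * plaqCost ρ W p)

omit [Group G] in
/-- `natCast_ne_zero_of_le` (slab bookkeeping, see the module docstring). -/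
theorem natCast_ne_zero_of_le (hj1 : 1 ≤ j) (hjn : j ≤ n) : ((j : ℕ) : ZMod (n + 1)) ≠ 0 := by
  rw [Ne, ZMod.natCast_eq_zero_iff]; intro h; have := Nat.le_of_dvd (by omega) h; omega

/-- The reflection exchanges the two boundary data of a glued configuration. -/
theorem slabReflect_glue (hj1 : 1 ≤ j) (hjn : j ≤ n) (U X A : GaugeConfig 4 (n + 1) G) :
    slabReflect μ j (glue μ j U A X) = glue μ j (slabReflect μ j U) X A := by
  have hj0 := natCast_ne_zero_of_le (n := n) j hj1 hjn
  funext ⟨x, k⟩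
  by_cases hk : k = μ
  · subst hk
    simp only [slabReflect, if_true]
    rw [glue_apply_other k j U A X (Or.inl rfl), glue_apply_other k j _ X A (Or.inl rfl)]
    simp only [slabReflect, if_true]
  · simp only [slabReflect, hk, if_false]
    by_cases h0 : x μ = 0
    · -- slice 0 of the result reads `X`; the reflected site is in slice `j` of `glue U A X`, which reads `X`
      have hθ : siteReflect μ j x μ = (j : ZMod (n + 1)) := by rw [siteReflect_apply_self, h0, sub_zero]
      rw [glue_apply_sliceJ μ j U A X hk hj0 hθ, glue_apply_slice0 μ j _ X A hk h0]
      have hx : siteReflect μ j x - Pi.single μ (j : ZMod (n + 1)) = x := by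
        ext i; by_cases hi : i = μ
        · subst hi; simp [h0]
        · simp [hi]
      dsimp only; rw [hx]
    · by_cases hxj : x μ = (j : ZMod (n + 1))
      · have hθ : siteReflect μ j x μ = 0 := by rw [siteReflect_apply_self, hxj, sub_self]
        rw [glue_apply_slice0 μ j U A X hk hθ, glue_apply_sliceJ μ j _ X A hk hj0 hxj]
        have hx : siteReflect μ j x = x - Pi.single μ (j : ZMod (n + 1)) := by
          ext i; by_cases hi : i = μ
          · subst hi; simp [hxj]
          · simp [hi]
        dsimp only; rw [hx]
      · have hθ0 : siteReflect μ j x μ ≠ 0 := by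
          rw [siteReflect_apply_self]; intro h; exact hxj (sub_eq_zero.mp h).symm
        have hθj : siteReflect μ j x μ ≠ (j : ZMod (n + 1)) := by
          rw [siteReflect_apply_self]; intro h; exact h0 (by simpa using h)
        rw [glue_apply_other μ j U A X (Or.inr ⟨hθ0, hθj⟩), glue_apply_other μ j _ X A (Or.inr ⟨h0, hxj⟩)]
        simp only [slabReflect, hk, if_false]

end ReflectionProps

section ReflectionMeasure

variable {n : ℕ} {G : Type*} [Group G] [TopologicalSpace G] [IsTopologicalGroup G] [CompactSpace G]
  [MeasurableSpace G] [BorelSpace G] [SecondCountableTopology G] {N : ℕ} (ρ : G →* Matrix (Fin N) (Fin N) ℂ) (μ : Fin 4)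

local notation "Ω" => GaugeConfig 4 (n + 1) G
local notation "πH" => (MeasureTheory.Measure.pi (fun _ : Edge 4 (n + 1) => haarProbability G))

omit [SecondCountableTopology G] in
/-- **The slab reflection preserves the product Haar measure.** -/
theorem measurePreserving_slabReflect (j : ℕ) : MeasurePreserving (slabReflect (G := G) μ j) πH πH := by
  have h1 : MeasurePreserving
      (MeasurableEquiv.arrowCongr' (Function.Involutive.toPerm (edgeReflect (n := n) μ j) (edgeReflect_edgeReflect μ j)) (MeasurableEquiv.refl G)) πH πH :=
    measurePreserving_arrowCongr' (fun _ => haarProbability G) (fun _ => haarProbability G)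
      (Function.Involutive.toPerm (edgeReflect (n := n) μ j) (edgeReflect_edgeReflect μ j)) (MeasurableEquiv.refl G) fun _ => MeasurePreserving.id _
  have h2 : MeasurePreserving (fun (V : Ω) (e : Edge 4 (n + 1)) => (if e.2 = μ then (fun g : G => g⁻¹) else id) (V e)) πH πH := by
    refine measurePreserving_pi _ _ fun e => ?_
    split_ifs
    · exact Measure.measurePreserving_inv _
    · exact MeasurePreserving.id _
  have heq : (slabReflect (G := G) μ j) =
      (fun (V : Ω) (e : Edge 4 (n + 1)) => (if e.2 = μ then (fun g : G => g⁻¹) else id) (V e)) ∘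
        (MeasurableEquiv.arrowCongr' (Function.Involutive.toPerm (edgeReflect (n := n) μ j) (edgeReflect_edgeReflect μ j)) (MeasurableEquiv.refl G)) := by
    funext U e
    have happ : (MeasurableEquiv.arrowCongr' (Function.Involutive.toPerm (edgeReflect (n := n) μ j) (edgeReflect_edgeReflect μ j)) (MeasurableEquiv.refl G)) U e =
        U ((Function.Involutive.toPerm (edgeReflect (n := n) μ j) (edgeReflect_edgeReflect μ j)).symm e) := rfl
    have hsymm : (Function.Involutive.toPerm (edgeReflect (n := n) μ j) (edgeReflect_edgeReflect μ j)).symm e = edgeReflect μ j e := rfl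
    rw [slabReflect_apply, Function.comp_apply, happ, hsymm]
  rw [heq]
  exact h2.comp h1

/-- **The slab kernel is symmetric**: `Ψ_j(X, A) = Ψ_j(A, X)` (reflection positivity bookkeeping: reflect the slab). -/
theorem slabKernel_symm (hρ : Continuous ρ) (hU : ∀ g, ρ g ∈ Matrix.unitaryGroup (Fin N) ℂ) (β : ℝ) {j : ℕ} (hj1 : 1 ≤ j)
    (hjn : j ≤ n) (X A : Ω) : slabKernel ρ μ β j X A = slabKernel ρ μ β j A X := by
  unfold slabKernel
  symm
  calc ∫ U, Real.exp (-(β * slabAction ρ μ j (glue μ j U A X))) ∂πH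
      = ∫ U, Real.exp (-(β * slabAction ρ μ j (slabReflect μ j (glue μ j U A X)))) ∂πH := by
        simp_rw [slabAction_slabReflect ρ μ j hU hjn]
    _ = ∫ U, Real.exp (-(β * slabAction ρ μ j (glue μ j (slabReflect μ j U) X A))) ∂πH := by
        simp_rw [slabReflect_glue μ j hj1 hjn]
    _ = ∫ U, Real.exp (-(β * slabAction ρ μ j (glue μ j U X A))) ∂πH :=
        integral_comp_mp (measurePreserving_slabReflect μ j)
          ((Real.continuous_exp.measurable).comp ((((continuous_slabAction ρ μ hρ j).measurable.comp
            (measurable_glue_left μ j X A)).const_mul β).neg))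

end ReflectionMeasure

end Summit.QuantumFields.YangMills.Theorems.CentreWallReflection.Slab

end
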